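import Mathlib
import HarnessLib
import Summits.ValiantsHypothesis.ValiantsHypothesis.Theses.MonotoneRestoration
import Summits.ValiantsHypothesis.ValiantsHypothesis.Theorems.MonotoneRestorationTargetImpliesCrux
import Summits.ValiantsHypothesis.ValiantsHypothesis.Theorems.MonotoneRestorationDenseSubtraction
import Summits.ValiantsHypothesis.ValiantsHypothesis.Theorems.MonotoneRestorationCruxToTarget
import Summits.ValiantsHypothesis.ValiantsHypothesis.Theorems.MonotoneRestorationSensitiveBridge
import Summits.ValiantsHypothesis.ValiantsHypothesis.Theorems.MonotoneRestorationPolylogWidthMonotoneEasyStatus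
import Summits.ValiantsHypothesis.ValiantsHypothesis.Theorems.MonotoneRestorationMonotoneRestorationQPFooling
import Summits.ValiantsHypothesis.ValiantsHypothesis.Theorems.MonotoneRestorationMonotoneRestorationQPRealBridge

/-!
# THEOREM ε — signs and monotonicity are free (crux `MonotoneRestorationQP`, line `Sketch`, lead c3)

Support file for the crux item `stmt-ValiantsHypothesis-15886`
(`Summit.ValiantsHypothesis.ValiantsHypothesis.Theses.MonotoneRestoration.MonotoneRestorationQP`).

* `realSensitiveBridge` — Hrubeš's bridge for REAL matrix-symmetric VP families (family form of
  the stub E1 `stub_realBridge`): `map g_n = (1 + Σ x)^{d n} + ε_n · q_n` with `g_n ∈ ℝ≥0[x_ij]`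
  matrix-symmetric, monotone-cheap, `d n ≤ (n+2)^c`.
* `monotoneRestorationQP_iff_realRestorationQP` — the crux is EQUIVALENT to quasi-polynomial
  square-symmetric restoration for every REAL matrix-symmetric family of polynomial degree and
  polynomial circuit complexity over `ℂ` (no sign condition on the coefficients, no monotone
  circuit in the hypothesis).  With the route's `monotoneRestorationQP_iff_target` (p135380) the
  three statements crux / target `NonnegRestorationQP` / real restoration coincide.
* `monotoneRestorationQP_of_diagonalRestorationQP` — the crux follows from restoration for
  DIAGONALLY invariant VP families over `ℂ` (the statement of `ProofCarryingSymmetry.RestorationQP`,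
  item stmt-ValiantsHypothesis-10343, inlined to avoid a cross-route import).
* `not_monotoneRestorationQP_of_real_separating` — refutation instrument at polylog scale for REAL
  polynomials: one exponent `c` and, for every level `c'`, a real matrix-symmetric `q` on some
  `n × n` matrix with `deg q ≤ (n+2)^c`, `L_ℂ(q) ≤ (n+2)^c` and two `C^{(log₂ n + c')^{c'}}`-equivalent
  graphs separated by `q`, kill the crux.

So a counterexample to the crux is exactly a real (equivalently complex, by real/imaginary parts)
matrix-symmetric VP family of super-polylogarithmic counting width — Dwivedi–Pago–Seppelt 2026,
Outlook Q3, for the matrix action; nonnegativity of the coefficients and monotonicity of the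
circuit carry no information.
-/

set_option linter.dupNamespace false

namespace Summit.ValiantsHypothesis.ValiantsHypothesis.Theorems

open Summit.ValiantsHypothesis.ValiantsHypothesis.Theses.MonotoneRestoration
open Literature.Computability.AlgebraicComplexity
open Literature.ModelTheory.FiniteModelTheory

/-- **Hrubeš's bridge for REAL matrix-symmetric families.** For every matrix-symmetric family
`q_n ∈ ℝ[x_ij]` whose complexification is a `VP` family there is `c` such that for every `n` there
are `d ≤ (n+2)^c`, `ε > 0` and a matrix-symmetric `g ∈ ℝ≥0[x_ij]` with
`map g = (1 + Σ_ij x_ij)^d + ε · q_n`, `deg g ≤ (n+2)^c` and monotone complexity `≤ (n+2)^c`.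
Family form of E1 `stub_realBridge` with the exponent arithmetic `size_exponent` of the route's
`SensitiveBridge`. [cite: Hrubes2020, Thm 1] -/
theorem realSensitiveBridge (q : (n : ℕ) → MvPolynomial (Fin n × Fin n) ℝ)
    (hsymm : ∀ (n : ℕ) (σ τ : Equiv.Perm (Fin n)),
      MvPolynomial.rename (fun p : Fin n × Fin n => (σ p.1, τ p.2)) (q n) = q n)
    (hVP : IsVPFamily (fun n => MvPolynomial.map Complex.ofRealHom (q n))) :
    ∃ c : ℕ, ∀ n : ℕ, ∃ (d : ℕ) (ε : ℝ), 0 < ε ∧ d ≤ (n + 2) ^ c ∧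
      ∃ g : MvPolynomial (Fin n × Fin n) NNReal,
        MvPolynomial.map NNReal.toRealHom g =
          (1 + ∑ p : Fin n × Fin n, MvPolynomial.X p) ^ d + MvPolynomial.C ε * q n ∧
        g.totalDegree ≤ (n + 2) ^ c ∧
        (∀ σ τ : Equiv.Perm (Fin n),
          MvPolynomial.rename (fun p : Fin n × Fin n => (σ p.1, τ p.2)) g = g) ∧
        complexity (k := NNReal) g ≤ (n + 2) ^ c := by
  obtain ⟨⟨-, c₁, hc₁⟩, c₂, hc₂⟩ := hVP
  refine ⟨3 * (c₁ + c₂) + 23, fun n => ?_⟩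
  obtain ⟨ε, g, hε, hg, hdeg, hgsymm, hcx⟩ := stub_realBridge n (q n) (hsymm n)
  have hD : (q n).totalDegree ≤ n ^ c₁ + c₁ := by
    have h1 : (MvPolynomial.map Complex.ofRealHom (q n)).totalDegree ≤ n ^ c₁ + c₁ := hc₁ n
    rwa [MonotoneRestorationSensitive.totalDegree_map_of_injective Complex.ofRealHom.injective]
      at h1
  have hL : 6 * complexity (MvPolynomial.map Complex.ofRealHom (q n)) ≤ 6 * (n ^ c₂ + c₂) :=
    Nat.mul_le_mul_left 6 (hc₂ n)
  obtain ⟨hxK, hK⟩ := MonotoneRestorationSensitive.size_exponent n c₁ c₂ (q n).totalDegree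
    (6 * complexity (MvPolynomial.map Complex.ofRealHom (q n))) hD hL
  refine ⟨(q n).totalDegree, ε, hε, le_trans (by omega) hxK, g, hg, hdeg.trans (le_trans (by omega) hxK),
    hgsymm, hcx.trans hK⟩

/-- **THEOREM ε — the crux is equivalent to REAL matrix-symmetric restoration.**
`MonotoneRestorationQP` holds iff every matrix-symmetric family `q_n ∈ ℝ[x_ij]` (arbitrary signs)
whose complexification is a `VP` family (tree `IsVPFamily`: polynomially bounded degree and circuit
complexity over `ℂ`) has square-symmetric circuits over `ℂ` of size `≤ 2^((log₂ n + c)^c)`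
computing it. (`→`: `realSensitiveBridge`, the crux applied to the perturbed nonnegative family,
the route's PROVED `DenseSubtraction` and the bookkeeping `monotoneRestoration_cruxToTarget_size_le`;
`←`: a nonnegative family is a real family, then `stub_target_implies_crux`.) Signs and
monotonicity are costumes: the crux is Dwivedi–Pago–Seppelt 2026 Outlook Q3 for the matrix action.
[cite: Hrubes2020, Thm 1] [cite: DwivediPagoSeppelt2026, Outlook Q3] -/
theorem monotoneRestorationQP_iff_realRestorationQP :
    MonotoneRestorationQP ↔
    ∀ q : (n : ℕ) → MvPolynomial (Fin n × Fin n) ℝ,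
      (∀ (n : ℕ) (σ τ : Equiv.Perm (Fin n)),
        MvPolynomial.rename (fun p : Fin n × Fin n => (σ p.1, τ p.2)) (q n) = q n) →
      IsVPFamily (fun n => MvPolynomial.map Complex.ofRealHom (q n)) →
      ∃ c : ℕ, ∀ n : ℕ, ∃ (G : Type) (_ : Fintype G)
        (C : LabelledArithCircuit ℂ (Fin n × Fin n) Unit G),
        C.IsSymmetric (Equiv.Perm (Fin n)) ∧
          C.eval (C.output ()) = MvPolynomial.map Complex.ofRealHom (q n) ∧
          Fintype.card G ≤ 2 ^ ((Nat.log 2 n + c) ^ c) := by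
  constructor
  · intro hMR q hsymm hVP
    obtain ⟨c₁, hc₁⟩ := realSensitiveBridge q hsymm hVP
    choose d ε hε hd g hg_map hg_deg hg_symm hg_cx using hc₁
    obtain ⟨c₂, hc₂⟩ := hMR g hg_symm ⟨c₁, fun n => ⟨hg_deg n, hg_cx n⟩⟩
    obtain ⟨c₃, hc₃⟩ := monotoneRestoration_cruxToTarget_size_le c₁ c₂
    refine ⟨c₃, fun n => ?_⟩
    obtain ⟨G, inst, C, hCsymm, hCeval, hCcard⟩ := hc₂ n
    have hCeval' : C.eval (C.output ()) =
        (1 + ∑ p : Fin n × Fin n, MvPolynomial.X p) ^ d n +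
          MvPolynomial.C ((ε n : ℝ) : ℂ) * MvPolynomial.map Complex.ofRealHom (q n) := by
      rw [hCeval, ← MvPolynomial.map_map, hg_map n]
      simp only [map_add, map_pow, map_one, map_sum, MvPolynomial.map_X, map_mul,
        MvPolynomial.map_C, Complex.ofRealHom_eq_coe]
    obtain ⟨G', inst', C', hC'symm, hC'eval, hC'card⟩ :=
      denseSubtraction_proof n (d n) (ε n) (hε n).ne'
        (MvPolynomial.map Complex.ofRealHom (q n)) G C hCsymm hCeval'
    refine ⟨G', inst', C', hC'symm, hC'eval, ?_⟩
    calc Fintype.card G' ≤ Fintype.card G + d n + n * n + 16 := hC'card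
      _ ≤ 2 ^ ((Nat.log 2 n + c₂) ^ c₂) + (n + 2) ^ c₁ + n * n + 16 := by
          have := hd n; omega
      _ ≤ 2 ^ ((Nat.log 2 n + c₃) ^ c₃) := hc₃ n
  · intro hR
    refine stub_target_implies_crux fun h hsymm hVP => ?_
    have hsymm' : ∀ (n : ℕ) (σ τ : Equiv.Perm (Fin n)),
        MvPolynomial.rename (fun p : Fin n × Fin n => (σ p.1, τ p.2))
          (MvPolynomial.map NNReal.toRealHom (h n)) = MvPolynomial.map NNReal.toRealHom (h n) := by
      intro n σ τ
      rw [← MvPolynomial.map_rename, hsymm n σ τ]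
    have hVP' : IsVPFamily (fun n => MvPolynomial.map Complex.ofRealHom
        (MvPolynomial.map NNReal.toRealHom (h n))) := by
      simpa only [MvPolynomial.map_map] using hVP
    obtain ⟨c, hc⟩ := hR (fun n => MvPolynomial.map NNReal.toRealHom (h n)) hsymm' hVP'
    refine ⟨c, fun n => ?_⟩
    obtain ⟨G, inst, C, hCsymm, hCeval, hCcard⟩ := hc n
    exact ⟨G, inst, C, hCsymm, by rw [hCeval, MvPolynomial.map_map], hCcard⟩

/-- **Diagonal restoration implies the crux.** If every DIAGONALLY `S_n`-invariant `VP` family over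
`ℂ` on the `n × n` matrix has quasi-polynomial square-symmetric circuits (the statement of
`ProofCarryingSymmetry.RestorationQP`, item stmt-ValiantsHypothesis-10343, written out), then
`MonotoneRestorationQP` holds: a matrix-symmetric nonnegative family of polynomial degree and
polynomial monotone complexity complexifies to a diagonally invariant `VP` family
(`ArithCircuit.complexity_map_le`, `targetImpliesCrux_pow_bound`). [folklore] -/
theorem monotoneRestorationQP_of_diagonalRestorationQP
    (hR : ∀ f : (n : ℕ) → MvPolynomial (Fin n × Fin n) ℂ,
      (∀ (n : ℕ) (σ : Equiv.Perm (Fin n)),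
        MvPolynomial.rename (fun x : Fin n × Fin n => σ • x) (f n) = f n) →
      IsVPFamily f →
      ∃ c : ℕ, ∀ n : ℕ, ∃ (G : Type) (_ : Fintype G)
        (C : LabelledArithCircuit ℂ (Fin n × Fin n) Unit G),
        C.IsSymmetric (Equiv.Perm (Fin n)) ∧ C.eval (C.output ()) = f n ∧
          Fintype.card G ≤ 2 ^ ((Nat.log 2 n + c) ^ c)) :
    MonotoneRestorationQP := by
  intro f hsymm hmono
  obtain ⟨c, hc⟩ := hmono
  refine hR (fun n => MvPolynomial.map (Complex.ofRealHom.comp NNReal.toRealHom) (f n)) ?_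
    ⟨⟨⟨2, fun n => ?_⟩, ⟨2 * c + 3 ^ c, fun n => ?_⟩⟩, ⟨2 * c + 3 ^ c, fun n => ?_⟩⟩
  · intro n σ
    have hfun : (fun x : Fin n × Fin n => σ • x) = fun p : Fin n × Fin n => (σ p.1, σ p.2) := by
      funext p; rfl
    rw [hfun, ← MvPolynomial.map_rename, hsymm n σ σ]
  · simp only [Fintype.card_prod, Fintype.card_fin]
    nlinarith
  · calc (MvPolynomial.map (Complex.ofRealHom.comp NNReal.toRealHom) (f n)).totalDegree
        ≤ (f n).totalDegree := Finset.sup_mono (MvPolynomial.support_map_subset _ _)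
      _ ≤ (n + 2) ^ c := (hc n).1
      _ ≤ n ^ (2 * c + 3 ^ c) + (2 * c + 3 ^ c) := targetImpliesCrux_pow_bound n c
  · calc complexity (MvPolynomial.map (Complex.ofRealHom.comp NNReal.toRealHom) (f n))
        ≤ complexity (f n) := ArithCircuit.complexity_map_le _ _
      _ ≤ (n + 2) ^ c := (hc n).2
      _ ≤ n ^ (2 * c + 3 ^ c) + (2 * c + 3 ^ c) := targetImpliesCrux_pow_bound n c

/-- The complexified form of the identity `map g = (1 + Σ x)^d + ε q`. [folklore] -/
theorem realBridge_map_complex {n d : ℕ} {ε : ℝ} {g : MvPolynomial (Fin n × Fin n) NNReal}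
    {q : MvPolynomial (Fin n × Fin n) ℝ}
    (hg : MvPolynomial.map NNReal.toRealHom g =
      (1 + ∑ p : Fin n × Fin n, MvPolynomial.X p) ^ d + MvPolynomial.C ε * q) :
    MvPolynomial.map (Complex.ofRealHom.comp NNReal.toRealHom) g =
      (1 + ∑ p : Fin n × Fin n, MvPolynomial.X p) ^ d +
        MvPolynomial.C ((ε : ℝ) : ℂ) * MvPolynomial.map Complex.ofRealHom q := by
  rw [← MvPolynomial.map_map, hg]
  simp only [map_add, map_pow, map_one, map_sum, MvPolynomial.map_X, map_mul,
    MvPolynomial.map_C, Complex.ofRealHom_eq_coe]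

/-- **Refutation instrument for REAL polynomials at polylog scale.** If for one exponent `c` and
EVERY level `c'` there is a real matrix-symmetric `q` on some `n × n` matrix with
`deg q ≤ (n+2)^c`, circuit complexity of its complexification `≤ (n+2)^c`, and two
`C^{(log₂ n + c')^{c'}}`-equivalent graphs on `Fin n` whose `0/1` adjacency matrices `q` separates,
then `MonotoneRestorationQP` is false: E1 turns `q` into a monotone-cheap nonnegative
matrix-symmetric `g` with `map g = (1 + Σ x)^{deg q} + ε q`, the dense part takes equal values on
`C^2`-equivalent graphs (`eval_densePart_eq_of_ckEquiv`), and the route's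
`not_monotoneRestorationQP_of_separating` (crux ⇒ Fooling) finishes. No sign or monotonicity
condition on `q`. [cite: Hrubes2020, Thm 1] [cite: DawarWilsenach2025, §6 p. 17] -/
theorem not_monotoneRestorationQP_of_real_separating
    (h : ∃ c : ℕ, ∀ c' : ℕ, ∃ (n : ℕ) (q : MvPolynomial (Fin n × Fin n) ℝ),
      (∀ σ τ : Equiv.Perm (Fin n),
        MvPolynomial.rename (fun p : Fin n × Fin n => (σ p.1, τ p.2)) q = q) ∧
      q.totalDegree ≤ (n + 2) ^ c ∧
      complexity (MvPolynomial.map Complex.ofRealHom q) ≤ (n + 2) ^ c ∧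
      ∃ X Y : SimpleGraph (Fin n), CkEquiv ((Nat.log 2 n + c') ^ c') X Y ∧
        MvPolynomial.eval (Set.indicator {ij : Fin n × Fin n | X.Adj ij.1 ij.2} 1)
            (MvPolynomial.map Complex.ofRealHom q) ≠
          MvPolynomial.eval (Set.indicator {ij : Fin n × Fin n | Y.Adj ij.1 ij.2} 1)
            (MvPolynomial.map Complex.ofRealHom q)) :
    ¬ MonotoneRestorationQP := by
  intro hcrux
  obtain ⟨c, hc⟩ := h
  refine not_monotoneRestorationQP_of_separating
    ⟨3 * ((2 * c + 3 ^ c) + (2 * c + 3 ^ c)) + 23, fun c' => ?_⟩ hcrux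
  obtain ⟨n, q, hq, hdeg, hcx, X, Y, hXY, hne⟩ := hc (c' + 2)
  obtain ⟨ε, g, hε, hg, hgdeg, hgsymm, hgcx⟩ := stub_realBridge n q hq
  have hD : q.totalDegree ≤ n ^ (2 * c + 3 ^ c) + (2 * c + 3 ^ c) :=
    hdeg.trans (targetImpliesCrux_pow_bound n c)
  have hL : 6 * complexity (MvPolynomial.map Complex.ofRealHom q) ≤
      6 * (n ^ (2 * c + 3 ^ c) + (2 * c + 3 ^ c)) :=
    Nat.mul_le_mul_left 6 (hcx.trans (targetImpliesCrux_pow_bound n c))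
  obtain ⟨hxK, hK⟩ := MonotoneRestorationSensitive.size_exponent n (2 * c + 3 ^ c)
    (2 * c + 3 ^ c) q.totalDegree (6 * complexity (MvPolynomial.map Complex.ofRealHom q)) hD hL
  have hlevel2 : 2 ≤ (Nat.log 2 n + (c' + 2)) ^ (c' + 2) :=
    calc 2 ≤ Nat.log 2 n + (c' + 2) := by omega
      _ ≤ (Nat.log 2 n + (c' + 2)) ^ (c' + 2) := Nat.le_self_pow (by omega) _
  have hlevel : (Nat.log 2 n + c') ^ c' ≤ (Nat.log 2 n + (c' + 2)) ^ (c' + 2) :=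
    calc (Nat.log 2 n + c') ^ c' ≤ (Nat.log 2 n + (c' + 2)) ^ c' :=
          Nat.pow_le_pow_left (by omega) c'
      _ ≤ (Nat.log 2 n + (c' + 2)) ^ (c' + 2) := Nat.pow_le_pow_right (by omega) (by omega)
  refine ⟨n, g, hgsymm, hgdeg.trans (le_trans (by omega) hxK), hgcx.trans hK, X, Y,
    hXY.mono hlevel, ?_⟩
  have h2 : CkEquiv 2 X Y := hXY.mono hlevel2
  have hdense := eval_densePart_eq_of_ckEquiv h2 le_rfl ℂ q.totalDegree
  rw [indicator_adj_eq_ite, indicator_adj_eq_ite] at hne ⊢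
  rw [realBridge_map_complex hg]
  simp only [map_add, map_mul, MvPolynomial.eval_C]
  rw [hdense]
  intro heq
  apply hne
  have hε0 : ((ε : ℝ) : ℂ) ≠ 0 := by exact_mod_cast hε.ne'
  exact mul_left_cancel₀ hε0 (add_left_cancel heq)

end Summit.ValiantsHypothesis.ValiantsHypothesis.Theorems
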